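import Mathlib.GroupTheory.Index
import Literature.AnabelianGeometry.SemiGraphs.TemperedCoverings
import Literature.AnabelianGeometry.SemiGraphs.TemperedQuasiGeometric
import HarnessLib

/-!
# Semi-graphs of anabelioids, §3 (part 4): Proposition 3.6 and Theorem 3.7
# (the tempered fundamental group and its maximal compact subgroups)

Mochizuki, *Semi-graphs of anabelioids*, Publ. RIMS **42** (2006), §3, manuscript pp. 37–42
[cite: MochizukiSemiAnbd2006, §3 pp.37-42], typed over the local presentation
`ProfiniteSemiGraph` of `TemperedCoverings.lean`.

The hypotheses of Proposition 3.6 / Theorem 3.7 are §1–§2 notions owned by the [SemiAnbd] §1–2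
files (cell seat abc-iut-L3-t1). They are rendered here LOCALLY (`-- TODO-merge: abc-iut-L3-t1`),
in the sub-namespace `ProfiniteSemiGraph`, in the concrete language of the presentation
(connected / countable / graph are the §1 file's `SemiGraph.IsConnected` / `IsCountable` /
`IsGraph` of the underlying semi-graph): "of injective type" (Def. 2.1 p. 22), approximators / quasi-coherent / coherent (Def. 2.3
pp. 24–25: an approximator is a morphism to a semi-graph of FINITE groups of bounded order on the
same underlying semi-graph; it splits a family of finite coverings `H_c → G_c` iff the kernels of
`Π_c → F_c` act trivially on the `H_c`), totally elevated (Def. 2.4 (i) p. 25), verticially slim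
(Def. 2.4 (ii): `Π_v` slim), totally aloof / totally estranged (Def. 2.4 (iv) p. 26), morphisms of
semi-graphs of anabelioids and locally trivial / locally open ones (Def. 2.2 (ii) p. 24, Rmk. 2.4.2
p. 26: vertex and edge homomorphisms compatible with the branch maps up to conjugation).

Typed (named `def … : Prop` facts, each quantified over the presentation and the hypotheses):
* Proposition 3.6 (i)+(ii) existence of the tempered fundamental group (`ExistsTemperedPiChart`),
  (iii) `π₁^temp(G) ↪ π̂₁(G)` as residual finiteness (`TemperedPiResiduallyFinite`),
  (iv) functoriality + relative temp-slimness of locally open morphisms (`InducedHomOfMorphism`)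
  and "`B^temp(G)` is temp-slim" (`TemperedPiSlim`);
* `IsVerticialHom` / `IsEdgeHom` (the homomorphisms representing the outer homomorphisms of
  Thm. 3.7 (i)/(iii), pinned up to conjugation via the chart); Theorem 3.7 (i) `VerticialInjective`,
  (ii) `VerticialDistinct`, (iii) `CompactInVerticial`, (iv) `MaximalCompactIffVerticial` (edge-like
  subgroups of CLOSED edges, audit A-L3t2-F2).

All named facts carry, through `Prop36Hypotheses` / `TemperedPiChart.secondCountableTopology`, the
Galois-countability hypotheses required by the author's erratum [IUTchI] Rmk. 2.5.3 (ii) (E7).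

Deliberately NOT here: Proposition 3.6 (v) (needs the covering semi-graph `G'` of a tempered object
as a semi-graph of anabelioids — sequel), Corollary 3.9 and Remark 3.9.1 (sequel
`TemperedReconstruction.lean`), Remark 3.5.2 (the full embedding of `B^cov(G)` into semi-graphs of
anabelioids over `G` — needs the §2 category), Remark 3.7.1 (expository: "maximal compact
subgroups correspond to points", not typed). No statement of the paper is strengthened; where a
local rendering of a §2 notion is coarser than print this is said in its docstring.
-/

open CategoryTheory Topology

namespace Literature.AnabelianGeometry.SemiGraphs

open Literature.AlgebraicGeometry.Frobenioids (IsSlimGroup)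

universe u

namespace ProfiniteSemiGraph

variable (𝒢 : ProfiniteSemiGraph.{u})

/-! ### Local renderings of the §1–§2 hypotheses (TODO-merge: abc-iut-L3-t1) -/

/-- `G` is *connected*: its underlying semi-graph is (§1 file; the standing hypothesis "connected"
of §3 p. 36). [cite: MochizukiSemiAnbd2006, §1 p.11] -/
abbrev IsConnected : Prop := 𝒢.graph.IsConnected

/-- "`G` has at least one vertex" (Thm. 3.7 p. 40). [cite: MochizukiSemiAnbd2006, Thm 3.7 p.40] -/
def HasVertex : Prop := Nonempty 𝒢.graph.Vertex

/-- `G` is a *graph* [of anabelioids]: every edge of the underlying semi-graph has verticial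
cardinality 2 (§1 p. 11; Def. 2.1 p. 22 "graph of anabelioids"). [cite: MochizukiSemiAnbd2006, §1 p.11] -/
abbrev IsGraph : Prop := 𝒢.graph.IsGraph

/-- `G` is *of injective type*: all the `b_*` are `π₁`-monomorphisms (Def. 2.1 p. 22).
[cite: MochizukiSemiAnbd2006, Def 2.1 p.22] -/
def IsOfInjectiveType : Prop :=
  ∀ (b : 𝒢.graph.Branch) (v : 𝒢.graph.Vertex) (h : 𝒢.graph.abuts b = some v),
    Function.Injective (𝒢.brHom b v h)

/-- `G` is *verticially slim*: every `G_v` is slim, i.e. every `Π_v` is a slim profinite group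
(Def. 2.4 (ii) p. 25 with §0 p. 6). [cite: MochizukiSemiAnbd2006, Def 2.4(ii) p.25] -/
def IsVerticiallySlim : Prop := ∀ v : 𝒢.graph.Vertex, IsSlimGroup (𝒢.Gv v)

/-- The edge `e` is *aloof* (resp. see `IsEstrangedEdge`) (Def. 2.4 (iv) p. 26): "for every vertex
`v` to which some branch `b` of `e` abuts and every `g ∈ Π_v`, the intersection in `Π_v` of `Π_b`
with any subgroup of the form `g · Π_{b'} · g⁻¹`, where either `b' ≠ b` is a branch of an edge that
abuts to `v` or `b' = b` and `g ∉ Π_b`, has infinite index in `Π_b`".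
[cite: MochizukiSemiAnbd2006, Def 2.4(iv) p.26] -/
def IsAloofEdge (e : 𝒢.graph.Edge) : Prop :=
  ∀ (b : 𝒢.graph.Branch), 𝒢.graph.edgeOf b = e → ∀ (v : 𝒢.graph.Vertex)
    (h : 𝒢.graph.abuts b = some v) (b' : 𝒢.graph.Branch) (h' : 𝒢.graph.abuts b' = some v)
    (g : 𝒢.Gv v), (b' ≠ b ∨ g ∉ 𝒢.branchSubgroup b v h) →
      ((𝒢.branchSubgroup b' v h').map (MulAut.conj g).toMonoidHom).relIndex
        (𝒢.branchSubgroup b v h) = 0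

/-- The edge `e` is *estranged* (Def. 2.4 (iv) p. 26): the same intersections "ha[ve] infinite index
in `Π_b` (respectively, AND [are], in fact, trivial)" — aloof and, moreover, the intersections are
trivial (as in the §2 file's `IsEstranged`; Rmk. 2.4.1 "estranged implies aloof").
[cite: MochizukiSemiAnbd2006, Def 2.4(iv) p.26] -/
def IsEstrangedEdge (e : 𝒢.graph.Edge) : Prop :=
  𝒢.IsAloofEdge e ∧
  ∀ (b : 𝒢.graph.Branch), 𝒢.graph.edgeOf b = e → ∀ (v : 𝒢.graph.Vertex)
    (h : 𝒢.graph.abuts b = some v) (b' : 𝒢.graph.Branch) (h' : 𝒢.graph.abuts b' = some v)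
    (g : 𝒢.Gv v), (b' ≠ b ∨ g ∉ 𝒢.branchSubgroup b v h) →
      𝒢.branchSubgroup b v h ⊓ (𝒢.branchSubgroup b' v h').map (MulAut.conj g).toMonoidHom = ⊥

/-- `G` is *totally aloof* (Def. 2.4 (iv) p. 26). [cite: MochizukiSemiAnbd2006, Def 2.4(iv) p.26] -/
def IsTotallyAloof : Prop := ∀ e : 𝒢.graph.Edge, 𝒢.IsAloofEdge e

/-- `G` is *totally estranged* (Def. 2.4 (iv) p. 26). [cite: MochizukiSemiAnbd2006, Def 2.4(iv) p.26] -/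
def IsTotallyEstranged : Prop := ∀ e : 𝒢.graph.Edge, 𝒢.IsEstrangedEdge e

/-- An *approximator* of `G` (Def. 2.3 (i)–(ii) pp. 24–25), rendered concretely: a semi-graph of
FINITE groups `F_v, F_e` of injective type and of bounded order on the SAME underlying semi-graph,
with continuous (= open-kernel) homomorphisms `Π_v → F_v`, `Π_e → F_e` compatible with the branch
maps up to conjugation (a 1-morphism of semi-graphs of anabelioids, Rmk. 2.4.2); it is
*`π₁`-epimorphic* when all these homomorphisms are surjective. Slightly COARSER than print: "of
bounded order" (Def. 2.3 (i)) bounds only the vertex groups, whereas here the edge groups `F_e` are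
also required finite (for an isolated edge print leaves them unconstrained) — so quasi-coherence /
elevatedness as rendered here are marginally stronger hypotheses.
[cite: MochizukiSemiAnbd2006, Def 2.3 pp.24-25] -/
structure Approximator : Type (u + 1) where
  /-- the finite vertex groups `π̂₁(G'_v)` -/
  FV : 𝒢.graph.Vertex → Type u
  /-- the finite edge groups `π̂₁(G'_e)` -/
  FE : 𝒢.graph.Edge → Type u
  [groupFV : ∀ v, Group (FV v)]
  [finiteFV : ∀ v, Finite (FV v)]
  [groupFE : ∀ e, Group (FE e)]
  [finiteFE : ∀ e, Finite (FE e)]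
  /-- `Π_v → F_v` -/
  πV : ∀ v, 𝒢.Gv v →* FV v
  /-- `Π_e → F_e` -/
  πE : ∀ e, 𝒢.Ge e →* FE e
  /-- continuity of `Π_v → F_v` (open kernel) -/
  isOpen_ker_πV : ∀ v, IsOpen ((πV v).ker : Set (𝒢.Gv v))
  /-- continuity of `Π_e → F_e` (open kernel) -/
  isOpen_ker_πE : ∀ e, IsOpen ((πE e).ker : Set (𝒢.Ge e))
  /-- the branch maps of `G'` -/
  brF : ∀ (b : 𝒢.graph.Branch) (v : 𝒢.graph.Vertex), 𝒢.graph.abuts b = some v →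
    (FE (𝒢.graph.edgeOf b) →* FV v)
  /-- `G'` is of injective type -/
  brF_injective : ∀ b v h, Function.Injective (brF b v h)
  /-- compatibility with the `b_*` up to conjugation (the 2-cells of Rmk. 2.4.2) -/
  comm : ∀ (b : 𝒢.graph.Branch) (v : 𝒢.graph.Vertex) (h : 𝒢.graph.abuts b = some v), ∃ g : FV v,
    ∀ x : 𝒢.Ge (𝒢.graph.edgeOf b), brF b v h (πE _ x) = g * πV v (𝒢.brHom b v h x) * g⁻¹
  /-- bounded order: "finite groups of order dividing `M`" for some `M ≥ 1` -/
  bounded : ∃ M : ℕ, 0 < M ∧ ∀ v, Nat.card (FV v) ∣ M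

attribute [instance] Approximator.groupFV Approximator.finiteFV Approximator.groupFE
  Approximator.finiteFE

/-- `π₁`-epimorphic approximators (Def. 2.3 (ii) p. 25). [cite: MochizukiSemiAnbd2006, Def 2.3(ii) p.25] -/
def Approximator.IsPiOneEpimorphic {𝒢 : ProfiniteSemiGraph.{u}} (A : 𝒢.Approximator) : Prop :=
  (∀ v, Function.Surjective (A.πV v)) ∧ ∀ e, Function.Surjective (A.πE e)

/-- `G` is *quasi-coherent* (Def. 2.3 (iii) p. 25): "for every integer `M ≥ 1`, and every collection
of finite étale coverings `H_c → G_c` of degree `≤ M`, where `c` ranges over the components of `G`,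
there exists an approximator `G → G'` such that, for each component `c` of `G`, the pull-back to `G_c`
of the 'universal covering' `H'_c → G'_c` of `G'_c` … splits `H_c → G_c`" — the coverings `H_c` being
finite continuous `Π_c`-sets of cardinality `≤ M` and the splitting being "the kernel of `Π_c → F_c`
acts trivially on `H_c`". [cite: MochizukiSemiAnbd2006, Def 2.3(iii) p.25] -/
def IsQuasiCoherent : Prop :=
  ∀ (M : ℕ) (HV : ∀ v : 𝒢.graph.Vertex, BTemp (𝒢.Gv v)) (HE : ∀ e : 𝒢.graph.Edge, BTemp (𝒢.Ge e)),
    (∀ v, Nat.card (HV v).obj.V ≤ M ∧ Finite (HV v).obj.V) →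
    (∀ e, Nat.card (HE e).obj.V ≤ M ∧ Finite (HE e).obj.V) →
    ∃ A : 𝒢.Approximator,
      (∀ v (g : 𝒢.Gv v), A.πV v g = 1 → ∀ x : (HV v).obj.V, (HV v).obj.ρ g x = x) ∧
      ∀ e (g : 𝒢.Ge e), A.πE e g = 1 → ∀ x : (HE e).obj.V, (HE e).obj.ρ g x = x

/-- `G` is *coherent* (Def. 2.3 (iii) p. 25): quasi-coherent and every `π̂₁(G_c)` is topologically
finitely generated. [cite: MochizukiSemiAnbd2006, Def 2.3(iii) p.25] -/
def IsCoherent : Prop :=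
  𝒢.IsQuasiCoherent ∧
    (∀ v, ∃ S : Finset (𝒢.Gv v), (Subgroup.closure (S : Set (𝒢.Gv v))).topologicalClosure = ⊤) ∧
    ∀ e, ∃ S : Finset (𝒢.Ge e), (Subgroup.closure (S : Set (𝒢.Ge e))).topologicalClosure = ⊤

/-- The vertex `v` is *elevated* (Def. 2.4 (i) p. 25): "for every integer `M ≥ 1`, there exists a
`π₁`-epimorphic approximator `G → G'` for `G` such that there exists a subgroup `N_M ⊆ π̂₁(G'_v)` of
order `≥ M` which has trivial intersection with all of the conjugates, in `π̂₁(G'_v)`, of all of the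
`π̂₁(G'_e)` [where `e` ranges over the edges abutting to `v`]".
[cite: MochizukiSemiAnbd2006, Def 2.4(i) p.25] -/
def IsElevatedVertex (v : 𝒢.graph.Vertex) : Prop :=
  ∀ M : ℕ, ∃ A : 𝒢.Approximator, A.IsPiOneEpimorphic ∧ ∃ N : Subgroup (A.FV v), M ≤ Nat.card N ∧
    ∀ (b : 𝒢.graph.Branch) (h : 𝒢.graph.abuts b = some v) (g : A.FV v),
      N ⊓ ((A.brF b v h).range.map (MulAut.conj g).toMonoidHom) = ⊥

/-- `G` is *totally elevated* (Def. 2.4 (i) p. 25). [cite: MochizukiSemiAnbd2006, Def 2.4(i) p.25] -/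
def IsTotallyElevated : Prop := ∀ v : 𝒢.graph.Vertex, 𝒢.IsElevatedVertex v

/-- The standing hypotheses of Proposition 3.6 (p. 38): "connected, countable, quasi-coherent,
totally elevated, totally aloof, verticially slim" (and of injective type, Def. 2.3's standing
assumption), together with Galois-countability ([IUTchI] Rmk. 2.5.3 (i) (T2)), which by (E7) of
loc. cit. "one must assume" in [SemiAnbd] 3.5–3.9, AND "`G` has at least one vertex": the
construction of `π₁^temp(G)` on p. 38 ("if `G` has at least one vertex", p. 36) and the temp-slimness
clause of Prop. 3.6 (iv) (via Cor. 2.7 (ii), which needs a vertex with slim `G_v`) use it — for the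
vertex-less semi-graph with one edge and `Π_e = ℤ/2` the facts below would otherwise be provably
false (reviewer's kernel-checked witness, p405440). [cite: MochizukiSemiAnbd2006, Prop 3.6 p.38] -/
structure Prop36Hypotheses : Prop where
  isConnected : 𝒢.IsConnected
  isCountable : 𝒢.IsCountable
  isGaloisCountable : 𝒢.IsGaloisCountable
  hasVertex : 𝒢.HasVertex
  isOfInjectiveType : 𝒢.IsOfInjectiveType
  isQuasiCoherent : 𝒢.IsQuasiCoherent
  isTotallyElevated : 𝒢.IsTotallyElevated
  isTotallyAloof : 𝒢.IsTotallyAloof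
  isVerticiallySlim : 𝒢.IsVerticiallySlim

/-- The standing hypotheses of Theorem 3.7 (p. 40): those of Proposition 3.6 (which here include
"`G` has at least one vertex") with "totally aloof" strengthened to "totally estranged" (estranged
edges are aloof with, moreover, trivial intersections). [cite: MochizukiSemiAnbd2006, Thm 3.7 p.40] -/
structure Thm37Hypotheses : Prop extends 𝒢.Prop36Hypotheses where
  isTotallyEstranged : 𝒢.IsTotallyEstranged

variable {𝒢} {ℋ : ProfiniteSemiGraph.{u}}

/-- A *morphism* of semi-graphs of anabelioids in the local presentation (Def. 2.1 p. 22 "evident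
notion of morphism", Rmk. 2.4.2 p. 26): a morphism of underlying semi-graphs (the §1 file's
`SemiGraph.Hom`) together with continuous homomorphisms of vertex and edge groups compatible with
the `b_*` up to conjugation (the edge group element is transported along
`edgeOf (branchMap b) = edgeMap (edgeOf b)`). [cite: MochizukiSemiAnbd2006, Rmk 2.4.2 p.26] -/
structure Hom (𝒢 ℋ : ProfiniteSemiGraph.{u}) : Type u where
  /-- the morphism of underlying semi-graphs -/
  base : SemiGraph.Hom 𝒢.graph ℋ.graph
  /-- the vertex homomorphisms `Π_v → Π_{f v}` -/
  hV : ∀ v, 𝒢.Gv v →ₜ* ℋ.Gv (base.vertexMap v)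
  /-- the edge homomorphisms `Π_e → Π_{f e}` -/
  hE : ∀ e, 𝒢.Ge e →ₜ* ℋ.Ge (base.edgeMap e)
  /-- compatibility with the branch maps up to conjugation -/
  comm : ∀ (b : 𝒢.graph.Branch) (v : 𝒢.graph.Vertex) (h : 𝒢.graph.abuts b = some v),
    ∃ g : ℋ.Gv (base.vertexMap v), ∀ x : 𝒢.Ge (𝒢.graph.edgeOf b),
      hV v (𝒢.brHom b v h x) =
        g * ℋ.brHom (base.branchMap b) (base.vertexMap v) (base.abuts_branchMap b v h)
          (base.edgeOf_branchMap b ▸ hE (𝒢.graph.edgeOf b) x) * g⁻¹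

/-- *Locally open* morphisms (Def. 2.2 (ii) p. 24): every vertex/edge homomorphism "induces a
homomorphism with open image between the respective `π̂₁(−)`'s".
[cite: MochizukiSemiAnbd2006, Def 2.2(ii) p.24] -/
def Hom.IsLocallyOpen (F : Hom 𝒢 ℋ) : Prop :=
  (∀ v, IsOpen ((F.hV v).toMonoidHom.range : Set (ℋ.Gv (F.base.vertexMap v)))) ∧
    ∀ e, IsOpen ((F.hE e).toMonoidHom.range : Set (ℋ.Ge (F.base.edgeMap e)))

/-- *Locally trivial* morphisms (Def. 2.2 (ii) p. 24): every vertex/edge homomorphism is an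
isomorphism of profinite groups. [cite: MochizukiSemiAnbd2006, Def 2.2(ii) p.24] -/
def Hom.IsLocallyTrivial (F : Hom 𝒢 ℋ) : Prop :=
  (∀ v, Function.Bijective (F.hV v)) ∧ ∀ e, Function.Bijective (F.hE e)

/-! ### Verticial and edge homomorphisms (Thm. 3.7 (i), used to pin outer homomorphisms) -/

/-- `ψ : Π_v → π₁^temp(G)` *is a verticial homomorphism at `v`* for the chart `c`: its pull-back
functor `B^temp(ψ)` is isomorphic to the restriction `B^temp(G) → G_v^⊤`, `S ↦ S_v`, transported
along the chart — i.e. `ψ` represents "the natural continuous … outer homomorphism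
`π̂₁(G_v) → π₁^temp(G)`" of Thm. 3.7 (i) (p. 40); by Prop. 3.2 this pins `ψ` down up to
`π₁^temp(G)`-conjugation (the verticial SUBGROUPS of `TemperedCoverings.lean` are the ranges of
these). [cite: MochizukiSemiAnbd2006, Thm 3.7(i) p.40] -/
def IsVerticialHom (c : TemperedPiChart 𝒢) (v : 𝒢.graph.Vertex) (ψ : 𝒢.Gv v →ₜ* c.G) : Prop :=
  Nonempty (c.equiv.inverse ⋙ ObjectProperty.ι _ ⋙ restrictV 𝒢 v ≅ BTemp.res ψ)

/-- `ψ : Π_e → π₁^temp(G)` *is an edge homomorphism at `e`*: the analogue for the restriction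
`S ↦ S_e` (Thm. 3.7 (iii) p. 41, "images of `π̂₁(G_e)`"). [cite: MochizukiSemiAnbd2006, Thm 3.7(iii) p.41] -/
def IsEdgeHom (c : TemperedPiChart 𝒢) (e : 𝒢.graph.Edge) (ψ : 𝒢.Ge e →ₜ* c.G) : Prop :=
  Nonempty (c.equiv.inverse ⋙ ObjectProperty.ι _ ⋙ restrictE 𝒢 e ≅ BTemp.res ψ)

/-! ### Proposition 3.6 (pp. 38–40) -/

/-- **Proposition 3.6 (i), (ii)** ([SemiAnbd] §3 p. 38), named fact: for `G` connected, countable,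
quasi-coherent, totally elevated, totally aloof, verticially slim, "(i) The topological group
`π₁^temp(G)` defined above is tempered. (ii) There is a natural equivalence of categories
`B^temp(π₁^temp(G)) ⥲ B^temp(G)`. In particular, the category `B^temp(G)` is a connected temperoid"
— i.e. a `TemperedPiChart` exists. [cite: MochizukiSemiAnbd2006, Prop 3.6(i)(ii) p.38] -/
def ExistsTemperedPiChart : Prop :=
  ∀ 𝒢 : ProfiniteSemiGraph.{u}, 𝒢.Prop36Hypotheses → Nonempty (TemperedPiChart 𝒢)

/-- **Proposition 3.6 (iii)** ([SemiAnbd] §3 p. 38), named fact: "The full embedding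
`B(G) ↪ B^temp(G)` induces an injection `π₁^temp(G) ↪ π̂₁(G)` of topological groups" — since the
finite objects of `B^temp(G)` are the finite étale coverings, `π̂₁(G)` is the profinite completion of
`π₁^temp(G)` and the statement is: the open normal subgroups of finite index of `π₁^temp(G)`
separate points. [cite: MochizukiSemiAnbd2006, Prop 3.6(iii) p.38] -/
def TemperedPiResiduallyFinite : Prop :=
  ∀ (𝒢 : ProfiniteSemiGraph.{u}), 𝒢.Prop36Hypotheses → ∀ (c : TemperedPiChart 𝒢) (g : c.G), g ≠ 1 →
    ∃ N : OpenNormalSubgroup c.G, Finite (c.G ⧸ N.toSubgroup) ∧ g ∉ (N : Set c.G)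

/-- **Proposition 3.6 (iv)** ([SemiAnbd] §3 p. 39), named fact: "Any morphism of semi-graphs of
anabelioids `G' → G` induces a morphism of temperoids `B^temp(G') → B^temp(G)` [by pulling back
tempered coverings of `G` to tempered coverings of `G'`]. Moreover, if the original morphism … is
locally open, then this morphism of temperoids is relatively temp-slim" — through charts
(Proposition 3.2): there is a continuous homomorphism `π₁^temp(G') → π₁^temp(G)` compatible, up to
conjugation, with the verticial HOMOMORPHISMS (`IsVerticialHom`, which pin the outer homomorphisms
of Thm. 3.7 (i); audit A-L3t2-F3, ruling κ) and the given `Π_{v'} → Π_{f v'}`, and it is relatively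
temp-slim when `G' → G` is locally open. [cite: MochizukiSemiAnbd2006, Prop 3.6(iv) p.39] -/
def InducedHomOfMorphism : Prop :=
  ∀ (𝒢' 𝒢 : ProfiniteSemiGraph.{u}), 𝒢'.Prop36Hypotheses → 𝒢.Prop36Hypotheses →
    ∀ (F : Hom 𝒢' 𝒢) (c' : TemperedPiChart 𝒢') (c : TemperedPiChart 𝒢),
      ∃ φ : c'.G →ₜ* c.G,
        (∀ (v' : 𝒢'.graph.Vertex) (ψ' : 𝒢'.Gv v' →ₜ* c'.G)
          (ψ : 𝒢.Gv (F.base.vertexMap v') →ₜ* c.G),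
          IsVerticialHom c' v' ψ' → IsVerticialHom c (F.base.vertexMap v') ψ →
            ∃ g : c.G, ∀ x, φ (ψ' x) = g * ψ (F.hV v' x) * g⁻¹) ∧
        (F.IsLocallyOpen → IsRelativelyTempSlim φ)

/-- **Proposition 3.6 (iv)**, last sentence ([SemiAnbd] §3 p. 39), named fact: "In particular, the
temperoid `B^temp(G)` is temp-slim" — every tempered fundamental group of `G` is a slim group.
[cite: MochizukiSemiAnbd2006, Prop 3.6(iv) p.39] -/
def TemperedPiSlim : Prop :=
  ∀ (𝒢 : ProfiniteSemiGraph.{u}), 𝒢.Prop36Hypotheses → ∀ c : TemperedPiChart 𝒢, IsSlimGroup c.G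

/-! ### Theorem 3.7 (pp. 40–41) -/

/-- **Theorem 3.7 (i)** ([SemiAnbd] §3 p. 40), named fact: "For each vertex `v` of `G`, there is a
natural continuous, injective outer homomorphism `π̂₁(G_v) ↪ π₁^temp(G)`" — the verticial
homomorphisms exist and are injective, so the verticial subgroups are "[necessarily compact!]"
copies of `Π_v`. [cite: MochizukiSemiAnbd2006, Thm 3.7(i) p.40] -/
def VerticialInjective : Prop :=
  ∀ (𝒢 : ProfiniteSemiGraph.{u}), 𝒢.Thm37Hypotheses → ∀ (c : TemperedPiChart 𝒢) (v : 𝒢.graph.Vertex),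
    (verticialSubgroups c v).Nonempty ∧
      ∀ φ : 𝒢.Gv v →ₜ* c.G, IsVerticialHom c v φ → Function.Injective φ

/-- **Theorem 3.7 (ii)** ([SemiAnbd] §3 p. 40), named fact: "Let us think of the verticial
subgroups as being parametrized by a vertex `v` of `G` and an element of the coset space
`π₁^temp(G)/π̂₁(G_v)`. Then if `H₁`, `H₂` are verticial subgroups of `π₁^temp(G)` that arise from
distinct parametrization data, then `H₁ ∩ H₂` has infinite index in `H₁`. In particular, verticial
subgroups that arise from distinct parametrization data are distinct."
[cite: MochizukiSemiAnbd2006, Thm 3.7(ii) p.40] -/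
def VerticialDistinct : Prop :=
  ∀ (𝒢 : ProfiniteSemiGraph.{u}), 𝒢.Thm37Hypotheses → ∀ (c : TemperedPiChart 𝒢),
    (∀ (v₁ v₂ : 𝒢.graph.Vertex) (H₁ H₂ : Subgroup c.G), H₁ ∈ verticialSubgroups c v₁ →
      H₂ ∈ verticialSubgroups c v₂ → v₁ ≠ v₂ → H₂.relIndex H₁ = 0) ∧
    ∀ (v : 𝒢.graph.Vertex) (H : Subgroup c.G), H ∈ verticialSubgroups c v →
      ∀ g₁ g₂ : c.G, g₁⁻¹ * g₂ ∉ H →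
      (H.map (MulAut.conj g₂).toMonoidHom).relIndex (H.map (MulAut.conj g₁).toMonoidHom) = 0

/-- **Theorem 3.7 (iii)** ([SemiAnbd] §3 pp. 40–41), named fact: "Every compact subgroup of
`π₁^temp(G)` is contained in at least one verticial subgroup. If a nontrivial compact subgroup of
`π₁^temp(G)` is contained in more than one verticial subgroup, then it is contained in precisely two
verticial subgroups … In particular, in this case, this compact subgroup is contained in the image
of some `π̂₁(G_e)`, for some edge `e` of `G`" — a CLOSED edge, the two vertices being "joined to one
another by a single [closed] edge" (print's edge-like subgroups are "such images", i.e. those of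
closed edges; open edges are not seen by `π₁^temp`, Rmk. 3.9.1 p. 43; audit A-L3t2-F2, ruling κ).
[cite: MochizukiSemiAnbd2006, Thm 3.7(iii) pp.40-41] -/
def CompactInVerticial : Prop :=
  ∀ (𝒢 : ProfiniteSemiGraph.{u}), 𝒢.Thm37Hypotheses → ∀ (c : TemperedPiChart 𝒢) (C : Subgroup c.G),
    IsCompact (C : Set c.G) →
      (∃ (v : 𝒢.graph.Vertex) (H : Subgroup c.G), H ∈ verticialSubgroups c v ∧ C ≤ H) ∧
      (C ≠ ⊥ → ∀ (v₁ v₂ : 𝒢.graph.Vertex) (H₁ H₂ : Subgroup c.G), H₁ ∈ verticialSubgroups c v₁ →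
        H₂ ∈ verticialSubgroups c v₂ → H₁ ≠ H₂ → C ≤ H₁ → C ≤ H₂ →
          (∀ (v₃ : 𝒢.graph.Vertex) (H₃ : Subgroup c.G), H₃ ∈ verticialSubgroups c v₃ → C ≤ H₃ →
              H₃ = H₁ ∨ H₃ = H₂) ∧
          ∃ (e : 𝒢.graph.Edge) (L : Subgroup c.G), 𝒢.graph.IsClosedEdge e ∧
            L ∈ edgeLikeSubgroups c e ∧ C ≤ L)

/-- **Theorem 3.7 (iv)** ([SemiAnbd] §3 p. 41), named fact: "The maximal compact subgroups of
`π₁^temp(G)` are precisely the verticial subgroups. The nontrivial intersections of two distinct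
maximal compact subgroups of `π₁^temp(G)` are precisely the edge-like subgroups" — the nontrivial
edge-like subgroups of CLOSED edges (those of Thm. 3.7 (iii), "such images"; an open edge's group
lies in a single verticial subgroup, cf. Rmk. 3.9.1 p. 43; audit A-L3t2-F2, ruling κ).
[cite: MochizukiSemiAnbd2006, Thm 3.7(iv) p.41] -/
def MaximalCompactIffVerticial : Prop :=
  ∀ (𝒢 : ProfiniteSemiGraph.{u}), 𝒢.Thm37Hypotheses → ∀ (c : TemperedPiChart 𝒢),
    (∀ K : Subgroup c.G, IsMaximalCompactSubgroup K ↔ ∃ v, K ∈ verticialSubgroups c v) ∧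
    ∀ L : Subgroup c.G, L ≠ ⊥ →
      ((∃ K₁ K₂ : Subgroup c.G, IsMaximalCompactSubgroup K₁ ∧ IsMaximalCompactSubgroup K₂ ∧
          K₁ ≠ K₂ ∧ L = K₁ ⊓ K₂) ↔ ∃ e, 𝒢.graph.IsClosedEdge e ∧ L ∈ edgeLikeSubgroups c e)

end ProfiniteSemiGraph

end Literature.AnabelianGeometry.SemiGraphs
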